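import Summits.QuantumFields.BalabanUV.T4Continuum.Support.NE7FlatSliceEnd
import Summits.QuantumFields.BalabanUV.T4Continuum.Spine.NE3.PairLandauB8
import HarnessLib

/-!
# NE7BalabanSliceLetterFlatWitness — THE LAST LETTER OF ROW NE7's CURVED (APE) END, **(KL-B)**, HOLDS AT THE FLAT BACKGROUND (a non-vacuity witness with the priced
# order `K_B ∝ L^j`): lineage #2's PROVED rank-one straight source letter (`NE7StraightSliceB5Letter.rankOneSourceSolver_holds`: lit-balaban's `B5G115SupBound`, the
# G-an2-4 swarm's `Entry115SupCubic` ∕ `AveragedPropagatorInverseUniform`) lifted to `Matrix n n ℂ` and to the functional form (`NE7FlatSliceChain` ∕ `NE7FlatSliceRankOne`),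
# read through row NE3's `QbarIter_flat` (file 119 of the curved (APE), F189)

Cell `pub-balaban`, rung (B)+1 sub-cell t4, lineage `b2b-balaban-t4-ne7-p1` (CRUX PROVER NE7 #1 = OWNER of row NE7), generation 84; memo `t4/b2b-balaban-t4-ne7-p1-g84/SCALAR-ROWS.md` §4.
WHY.  After F188 (`NE7ApeCurvedRepRoadBScalarFreeEnd`) the curved (APE) on road (B) rests on ONE letter `hB` = (KL-B): for skew periodic `X″` on Bałaban's STRAIGHT slice `ker QbarIter_W`
in the `IsLandauB8` gauge with `|hess W X″ Y| ≤ g″‖Y‖₁` on straight-tangent tests, `‖curl_W X″‖ ≤ K_B·g″`.  At a CURVED class background this is NE9's [B9] row (open behind the wall).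
At the FLAT background `W = 1` it is — up to the names `QbarIter L j 1 = (Qcoarse L)^[j]` (row NE3) and the period written `N·L^j` vs `L^j·N` — EXACTLY the straight-slice functional
letter that lineage #2 (CRUX PROVER NE7 #2) PROVED on cubic tori from the tree's [B5] (1.115) kernel theorems; the gauge hypothesis is not even needed there (the flat Hessian kills
pure gauges).  This file records the witness in the END's binder shape: the letter is consistent, and its constant has the priced order `K_B = (2(card n)³K(d))·L^j`.
WHAT ([folklore]; 0 def, 0 sorry).  **`balabanSliceLetter_flat_witness`** (dimension `d + 1`, any `L ≥ 1`, `j`, `N ≥ 1` with `L^j·N ≥ 2`): `∃ K ≥ 0` (depending on `d` only) such that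
F188's binder `hB` holds at `W = flat` with `K_B = L^j·(2(card n)³·K)`, for every level `j` and every volume `N`.
HONEST FRAMING (page 1): composition BY NAME of lineage #2's kernel theorems (the analysis behind them is lit-balaban's ∕ the G-an2-4 swarm's, cubic tori, `a = 1`) — a WITNESS at
the trivial background, NOT the curved letter; (KL-B) at a curved class background NOT proved; nothing of Bałaban's asserted; (APE) on curved data NOT proved; NOT ONE-STEP, NOT NE7;
spine 0∕9; finite T⁴ rung (B)+1 — NOT infinite volume, NOT mass gap, NOT `BetaPertH`, NOT Clay.  Continuum YM on T⁴ ⇐ BetaPertH ∧ nine spine estimates (0/9 proved); BetaPertH ⇐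
(D1) ∧ (D4) ∧ CAP+tail; G-an2-4 gates asym, D1 and NE2/3/4.
-/

set_option autoImplicit false

open scoped BigOperators Matrix Matrix.Norms.L2Operator
open Finset

namespace Summit.QuantumFields.BalabanUV.T4Continuum.NE7BalabanSliceLetterFlatWitness

open Literature.MathematicalPhysics.QuantumFieldTheory.Balaban1983to89
open B7Prop1Explicit
open T4AveragingDeficitWall (curlAt dirL1 IsSkewDir)
open T4AveragingDeficitWallBoundary (periodBox)
open AveragingDeficitPeriodicCounting (IsPeriodicDir)
open MinimalActionLevels (perWin)
open BlockAveragePushDirSplit (flat)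
open NE3HessForm (hess)
open NE3TangentCovariantTower (QbarIter QbarIter_flat)
open NE3TangentFlatStructure (Qcoarse)
open NE3.PairLandauB8 (IsLandauB8)
open NE7FlatSliceChain (straightSliceSolver_of_straightSourceSolver)
open NE7FlatSliceRankOne (straightSliceSolver_of_rankOne)
open NE7StraightSliceB5Letter (rankOneSourceSolver_holds)

noncomputable section

variable {n : Type*} [Fintype n] [DecidableEq n]

/-- **(KL-B) AT THE FLAT BACKGROUND — A WITNESS OF F188's LAST LETTER IN ITS OWN BINDER SHAPE** (dimension `d + 1`; `L ≥ 1`, `j`, `N ≥ 1`, `L^j·N ≥ 2`): there is `K = K(d) ≥ 0`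
such that for every skew `(N·L^j)`-periodic `X″` with `QbarIter L j 1 X″ = 0` (and, redundantly at `W = 1`, `IsLandauB8 L N j 1 X″`), every `g″ ≥ 0` with
`|hess 1 X″ Y| ≤ g″·‖Y‖_{ℓ¹}` for all skew periodic straight-tangent `Y`, and every plaquette: `‖curl_1 X″‖ ≤ (L^j·(2(card n)³K))·g″`. [folklore] -/
theorem balabanSliceLetter_flat_witness [Nonempty n] (d : ℕ) :
    ∃ K : ℝ, 0 ≤ K ∧ ∀ (L : ℕ) [NeZero L] (_hL : 1 ≤ L) (j N : ℕ) [NeZero N] (_hP : 2 ≤ L ^ j * N),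
      ∀ X'' : Site (d + 1) → Fin (d + 1) → Matrix n n ℂ, IsSkewDir X'' → IsPeriodicDir X'' ((N * L ^ j : ℕ) : ℤ) →
        QbarIter L j (flat (d := d + 1) (n := n)) X'' = 0 → IsLandauB8 (d := d + 1) L N j (flat (d := d + 1) (n := n)) X'' →
        ∀ g'' : ℝ, 0 ≤ g'' →
        (∀ Y : Site (d + 1) → Fin (d + 1) → Matrix n n ℂ, IsSkewDir Y → IsPeriodicDir Y ((N * L ^ j : ℕ) : ℤ) →
          QbarIter L j (flat (d := d + 1) (n := n)) Y = 0 →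
          |hess (flat (d := d + 1) (n := n)) X'' Y (perWin (d + 1) (N * L ^ j))| ≤ g'' * dirL1 Y (periodBox (d := d + 1) (N * L ^ j))) →
        ∀ z μ' ν', μ' ≠ ν' → ‖curlAt (flat (d := d + 1) (n := n)) X'' z μ' ν'‖ ≤ ((L : ℝ) ^ j * (2 * (Fintype.card n : ℝ) ^ 3 * K)) * g'' := by
  obtain ⟨K, hK0, hK⟩ := rankOneSourceSolver_holds d
  refine ⟨K, hK0, fun L _ hL j N _ hP => ?_⟩
  intro X'' hXs hXP hXQ _hXL g'' hg'' hfun z μ' ν' hμν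
  have hNL : N * L ^ j = L ^ j * N := Nat.mul_comm _ _
  haveI : NeZero (L ^ j * N) := ⟨by positivity⟩
  -- the rank-one SOURCE letter on the straight slice (lineage #2, PROVED) ⟹ the rank-one FUNCTIONAL letter ⟹ the rank-`n` functional letter
  have h1src := hK L hL j N hP
  have h1fun := straightSliceSolver_of_straightSourceSolver (d := d + 1) (n := Fin 1) L j (L ^ j * N) h1src
  rw [Fintype.card_fin, Nat.cast_one, one_mul] at h1fun
  have hn := straightSliceSolver_of_rankOne (n := n) L j (L ^ j * N) h1fun
  -- read our binders through `QbarIter L j 1 = (Qcoarse L)^[j]` and `N·L^j = L^j·N`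
  rw [hNL] at hXP hfun
  rw [QbarIter_flat hL] at hXQ
  have hfun' : ∀ Y : Site (d + 1) → Fin (d + 1) → Matrix n n ℂ, IsSkewDir Y → IsPeriodicDir Y ((L ^ j * N : ℕ) : ℤ) → (Qcoarse L)^[j] Y = 0 →
      |hess (flat (d := d + 1) (n := n)) X'' Y (perWin (d + 1) (L ^ j * N))| ≤ g'' * dirL1 Y (periodBox (d := d + 1) (L ^ j * N)) :=
    fun Y hYs hYP hYQ => hfun Y hYs hYP (by rw [QbarIter_flat hL]; exact hYQ)
  have h := hn X'' hXs hXP hXQ g'' hg'' hfun' z μ' ν' hμν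
  calc _ ≤ (2 * (Fintype.card n : ℝ) ^ 3 * (((L ^ j : ℕ) : ℝ) * K)) * g'' := h
    _ = ((L : ℝ) ^ j * (2 * (Fintype.card n : ℝ) ^ 3 * K)) * g'' := by push_cast; ring

end

end Summit.QuantumFields.BalabanUV.T4Continuum.NE7BalabanSliceLetterFlatWitness
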